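import Summits.Ventures.PercRepro.S2ElevenNineK2NuEight
import Summits.Ventures.PercRepro.S2ElevenNineK2NuFour
import Summits.Ventures.PercRepro.S2ElevenNineK2Spread
import Summits.Ventures.PercRepro.S2ElevenNineK2NuSevenTwelve
import Summits.Ventures.PercRepro.S2ElevenNineK2NuSevenEleven
import Summits.Ventures.PercRepro.S2ElevenNineK2NuSixEleven
import Summits.Ventures.PercRepro.S2ElevenNineK2NuSixTen
import Summits.Ventures.PercRepro.S2ElevenNineK2NuFiveThirteen
import Summits.Ventures.PercRepro.S2ElevenNineK2NuFiveTwelve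
import Summits.Ventures.PercRepro.S2ElevenNineK2NuFiveSimpleTen
import Summits.Ventures.PercRepro.S2ElevenNineK2NuFiveSimpleNine

/-!
# PercRepro — S2: THE TWICE-SCALED CELL `(11, 9)` OF `(13, 9)` AT `K₂ = 12107` (COLOOPS ALLOWED) — THE NESTED DICHOTOMY `ν = 8 → 7 → 6 → 5 → 4 → spread` (p7, gen 19; sub-claim S2; the row `p = 13`)

The twice-scaled cell `(11, 9)` of `(13, 9)` at `K₂ = 12107` (coloops allowed) (an `e`-free core of rank `11` on `20` points, coloops allowed) is a theorem: by the largest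
small-set nullity — `ν = 8` (a set of nullity `8` on `≤ 14` points: the kit's hitting counts), `ν = 7` (on `≤ 12` points: `11` or `12` points, the
exact-rank lever with `N` of nullity `2`), `ν = 6` (on `≤ 11`: `10` or `11` points, `N` of nullity `3`), `ν = 5` (on `≤ 10`: split by the largest
rank-`6` set — a `13`-point one (`N` of nullity `2`), a `12`-point one (`N` of nullity `3`), or none (`N = M ／ W` simple of nullity `4`, `W` of
`9` or `10` points)), `ν = 4` (on `≤ 9` points: the flat-sharp lever at `(9, 8)` with the spanning count through the set) and the spread case
(the flat-sharp lever at `(8, 7)` on the global caps). **`c025_eleven_nine_k2`**. Nothing beyond this cell is claimed. Axioms: standard.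
-/

open scoped Matroid

namespace PercRepro

namespace ThmN

open Set

variable {α : Type}

/-- **The twice-scaled cell `(11, 9)` of `(13, 9)` at `K₂ = 12107` (coloops allowed)** by the nested dichotomy on the nullity of the small sets. -/
theorem c025_eleven_nine_k2 (M : Matroid α) [M.Finite]
    (hR : M.eRank = ((11 : ℕ) : ℕ∞)) (hn : M.E.ncard = 11 + 9)
    (hfree : ∀ e ∈ M.E, ∃ A ⊆ M.E \ {e}, e ∉ M.closure A ∧ e ∉ M.closure ((M.E \ {e}) \ A)) :
    ((phiK 13 5 - 6) / 4) * (Matroid.topCount M 11 5 : ℚ) ≤ (Matroid.midCount M 11 5 : ℚ) := by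
  classical
  have hEfin := M.ground_finite
  have hL0 : ∀ e ∈ M.E, ¬ M.IsLoop e := not_isLoop_of_free M hfree
  have hs : ∀ e ∈ M.E, ∀ f ∈ M.E, e ≠ f → M.eRk {e, f} = 2 := by
    intro e he f hf hef
    have h2 : (2 : ℕ∞) ≤ M.eRk {e, f} :=
      two_le_eRk_of_two_le_ncard_of_free M hfree (pair_subset he hf) (by rw [ncard_pair hef])
    have h3 : M.eRk {e, f} ≤ 2 := by
      have := M.eRk_le_encard {e, f}
      rwa [encard_pair hef] at this
    exact le_antisymm h3 h2
  have hC1 : ∀ L ⊆ M.E, M.eRk L = 2 → L.ncard ≤ 3 :=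
    fun L hL hr => ncard_le_three_of_eRk_two M hs hfree hL hr
  by_cases h8 : ∃ W ⊆ M.E, W.ncard ≤ 14 ∧ W.encard = M.eRk W + 8
  · exact c025_eleven_nine_k2_nu_eight M hR hn hfree h8
  by_cases h7 : ∃ W ⊆ M.E, W.ncard ≤ 12 ∧ W.encard = M.eRk W + 7
  · -- `ν = 7`: the set has `11` or `12` points
    obtain ⟨W, hW, hWn, hWk⟩ := h7
    have hWfin : W.Finite := hEfin.subset hW
    have hWne : M.eRk W ≠ ⊤ := ((M.eRk_le_encard W).trans_lt hWfin.encard_lt_top).ne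
    obtain ⟨r, hr⟩ := ENat.ne_top_iff_exists.1 hWne
    have hWr : W.ncard = r + 7 := by
      have h := hWk
      rw [← hr, ← hWfin.cast_ncard_eq] at h
      exact_mod_cast h
    have hr4 : 4 ≤ r := by
      by_contra hlt
      push Not at hlt
      have h3 : M.eRk W ≤ 3 := by rw [← hr]; exact_mod_cast (by omega : r ≤ 3)
      have h6' := ncard_le_six_of_eRk_le_three_of_free M hfree hW h3
      omega
    rcases (show W.ncard = 12 ∨ W.ncard = 11 by omega) with h | h
    · exact c025_eleven_nine_k2_nu_seven_twelve M hR hn hfree h8 ⟨W, hW, h, hWk⟩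
    · exact c025_eleven_nine_k2_nu_seven_eleven M hR hn hfree h8 ⟨W, hW, h, hWk⟩
  by_cases h6 : ∃ W ⊆ M.E, W.ncard ≤ 11 ∧ W.encard = M.eRk W + 6
  · -- `ν = 6`: the set has `10` or `11` points
    obtain ⟨W, hW, hWn, hWk⟩ := h6
    have hWfin : W.Finite := hEfin.subset hW
    have hWne : M.eRk W ≠ ⊤ := ((M.eRk_le_encard W).trans_lt hWfin.encard_lt_top).ne
    obtain ⟨r, hr⟩ := ENat.ne_top_iff_exists.1 hWne
    have hWr : W.ncard = r + 6 := by
      have h := hWk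
      rw [← hr, ← hWfin.cast_ncard_eq] at h
      exact_mod_cast h
    have hr4 : 4 ≤ r := by
      by_contra hlt
      push Not at hlt
      have h3 : M.eRk W ≤ 3 := by rw [← hr]; exact_mod_cast (by omega : r ≤ 3)
      have h6' := ncard_le_six_of_eRk_le_three_of_free M hfree hW h3
      have h0 : M.eRk W ≤ 0 := by rw [← hr]; exact_mod_cast (by omega : r ≤ 0)
      have h0' := S2.ncard_le_zero_of_eRk_le_zero M hL0 hW h0
      omega
    rcases (show W.ncard = 11 ∨ W.ncard = 10 by omega) with h | h
    · exact c025_eleven_nine_k2_nu_six_eleven M hR hn hfree h7 ⟨W, hW, h, hWk⟩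
    · exact c025_eleven_nine_k2_nu_six_ten M hR hn hfree h7 ⟨W, hW, h, hWk⟩
  by_cases h5 : ∃ W ⊆ M.E, W.ncard ≤ 10 ∧ W.encard = M.eRk W + 5
  · -- `ν = 5`: by the largest rank-`6` set
    by_cases h13 : ∃ V ⊆ M.E, V.ncard ≤ 13 ∧ V.encard = M.eRk V + 7
    · obtain ⟨V, hV, hVn, hVk⟩ := h13
      have h13' : V.ncard = 13 := by
        by_contra hne
        exact h7 ⟨V, hV, by omega, hVk⟩
      exact c025_eleven_nine_k2_nu_five_thirteen M hR hn hfree h8 h6 ⟨V, hV, h13', hVk⟩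
    by_cases h12 : ∃ V ⊆ M.E, V.ncard ≤ 12 ∧ V.encard = M.eRk V + 6
    · obtain ⟨V, hV, hVn, hVk⟩ := h12
      have h12' : V.ncard = 12 := by
        by_contra hne
        exact h6 ⟨V, hV, by omega, hVk⟩
      exact c025_eleven_nine_k2_nu_five_twelve M hR hn hfree h13 h6 ⟨V, hV, h12', hVk⟩
    obtain ⟨W, hW, hWn, hWk⟩ := h5
    have hWfin : W.Finite := hEfin.subset hW
    have hWne : M.eRk W ≠ ⊤ := ((M.eRk_le_encard W).trans_lt hWfin.encard_lt_top).ne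
    obtain ⟨r, hr⟩ := ENat.ne_top_iff_exists.1 hWne
    have hWr : W.ncard = r + 5 := by
      have h := hWk
      rw [← hr, ← hWfin.cast_ncard_eq] at h
      exact_mod_cast h
    have hr4 : 4 ≤ r := by
      by_contra hlt
      push Not at hlt
      have h3 : M.eRk W ≤ 3 := by rw [← hr]; exact_mod_cast (by omega : r ≤ 3)
      have h6' := ncard_le_six_of_eRk_le_three_of_free M hfree hW h3
      have h1 : M.eRk W ≤ 1 := by rw [← hr]; exact_mod_cast (by omega : r ≤ 1)
      have h1' := S2.ncard_le_one_of_eRk_le_one M hs hW h1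
      omega
    rcases (show W.ncard = 10 ∨ W.ncard = 9 by omega) with h | h
    · exact c025_eleven_nine_k2_nu_five_simple_ten M hR hn hfree h6 h12 ⟨W, hW, h, hWk⟩
    · exact c025_eleven_nine_k2_nu_five_simple_nine M hR hn hfree h6 h12 ⟨W, hW, h, hWk⟩
  by_cases h4 : ∃ W ⊆ M.E, W.ncard ≤ 9 ∧ W.encard = M.eRk W + 4
  · exact c025_eleven_nine_k2_nu_four M hR hn hfree h5 h4
  · exact c025_eleven_nine_k2_spread M hR hn hfree h4

end ThmN

end PercRepro
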